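import Mathlib
import HarnessLib
import Summits.NavierStokesRegularity.NavierStokesRegularity.Theses.PoloidalWindowDoor
import Summits.NavierStokesRegularity.NavierStokesRegularity.Theorems.PoloidalWindowDoorPoloidalWindowRigidityEntireGerm
import Summits.NavierStokesRegularity.NavierStokesRegularity.Theorems.PoloidalWindowDoorPoloidalWindowRigidityLocalVorticitySymmetry
import Summits.NavierStokesRegularity.NavierStokesRegularity.Theorems.PoloidalWindowDoorPoloidalWindowRigidityVorticityTranslate
import Summits.NavierStokesRegularity.NavierStokesRegularity.Theorems.PoloidalWindowDoorPoloidalWindowRigidityOneSliceCurlAxisymmetric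
import Summits.NavierStokesRegularity.NavierStokesRegularity.Theorems.PoloidalWindowDoorPoloidalWindowRigidityTimeShearPressure
import Summits.NavierStokesRegularity.NavierStokesRegularity.Theorems.PoloidalWindowDoorPoloidalWindowRigidityFlat

/-!
# Route `PoloidalWindowDoor`, item `LrcModEntire` (stmt-NavierStokesRegularity-20428) — WHAT THE ITEM SAYS INSIDE THE CLASS:
# a symmetry germ of a class profile forces `v ≡ 0`, so `LrcModEntire` ⟺ «every non-degenerate poloidal class profile is (TV)»

Cell ns-regularity-ideate, seat ns-poloidal-K2-p3 gen 5 (LEAD of item 20428, skeleton `slope-split`; file landed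
`--supports stmt-NavierStokesRegularity-20428` as a helper).

`LrcModEntire` (= the v3 stub of crux K2, promoted) concludes, on a non-degenerate open space–time set with spatially varying
slope, a TRICHOTOMY on some slice and some nonempty open set: translation germ of the vorticity ∨ rotation germ about a vertical
axis ∨ agreement with an entire real-analytic field unbounded on `ℝ³`.  For a profile OF THE CLASS each leg is fatal:
a translation germ spreads to the slice (identity theorem, ns-poloidal-K2-p3 g3 `…LocalVorticitySymmetry`) and kills the profile
(this base's `…VorticityTranslate.eq_zero_of_curl_translate_eq_slice`); a rotation germ kills it by K2-p1's one-slice any-axis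
stratum (`…OneSliceCurlAxisymmetric.eq_zero_of_curl_rotDefect_eq_zero_on_open`); the entire leg is absurd (nsreg-p7 g8
`…EntireGerm`).  Hence:

* `eq_zero_of_germ` — class + poloidal + the germ trichotomy on `(s, U)` ⇒ `v ≡ 0` on the slab;
* `false_of_germ_of_nondegenerate` — … so on a profile with ONE vortical point of the slab the trichotomy is contradictory;
* `timeHeightShear_of_germStub` — TRANSFER for the two skeletons: this seat's registered stub `stub_timeHeightShearGerm` of
  20428 (germ currency), as a fully quantified hypothesis, implies VERBATIM the K2 lead's v4 stub `stub_timeHeightShear` of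
  19708 (`¬ IsBackwardSingularPoint` currency) — indeed the stronger `v ≡ 0`; ONE landing of the germ stub closes both;
* `lrcModEntire_iff_timeOnly_dense` — **`LrcModEntire` ⟺ for every poloidal class profile and every nonempty open
  non-degenerate subset `W` of the slab, the shear slope IS a function of time alone on some nonempty open `W₁ ⊆ W`**
  (⇒: otherwise the item yields a germ, hence `v ≡ 0`, contradicting `curl v ≠ 0` on `W`; ⇐: the item's hypotheses are then
  never met);
* `lrcModEntire_iff_timeShear` — **`LrcModEntire` ⟺ every poloidal class profile that is non-degenerate at ONE point of
  the slab is GLOBALLY (TV)**: one negative slope `μ(s)` per slice with `∂₂v_b(s,·) ≡ μ(s) ∂_b v₂(s,·)`, `b = 0,1`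
  (this base's `…TimeShear.timeShear_of_local` spreads a time-only slope from an open set to all slices).
  So the item is EXACTLY the Liouville-type statement «(TH) ∪ thick stratum is EMPTY in the class»; no local-symmetry
  language survives inside the class, and the (TV) profiles themselves are only known to be non-singular
  (`…TimeShearClosed`), not trivial.

WHAT THIS IS NOT: not a claim about Navier–Stokes regularity and not a proof of `LrcModEntire` — its reformulation inside the
class and the transfer between the two registered (TH) stubs (bears_on LADDER-NS N0 via items 20428 / 19708).
-/

noncomputable section

-- the summit and its single sub-problem share the name (CONVENTIONS §1), as in every Theorems file
set_option linter.dupNamespace false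

namespace Summit.NavierStokesRegularity.NavierStokesRegularity.Theorems.PoloidalWindowDoorLrcModEntireIff

open Set Function Filter Topology Metric
open scoped RealInnerProductSpace InnerProductSpace
open Literature.Analysis Literature.Analysis.FluidPDE
open Summit.NavierStokesRegularity.NavierStokesRegularity.Theses.PoloidalWindowDoor
open Summit.NavierStokesRegularity.NavierStokesRegularity.Theorems.LocalSineTubeDoorProfileAlignedWindowRigidityAncient
open Summit.NavierStokesRegularity.NavierStokesRegularity.Theorems.TubeAlternative.AnalyticPropagation
open Summit.NavierStokesRegularity.NavierStokesRegularity.Theorems.PoloidalWindowDoorPoloidalWindowRigidityEntireGerm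
open Summit.NavierStokesRegularity.NavierStokesRegularity.Theorems.PoloidalWindowDoorPoloidalWindowRigidityLocalVorticitySymmetry
open Summit.NavierStokesRegularity.NavierStokesRegularity.Theorems.PoloidalWindowDoorPoloidalWindowRigidityVorticityTranslate
open Summit.NavierStokesRegularity.NavierStokesRegularity.Theorems.PoloidalWindowDoorPoloidalWindowRigidityOneSliceCurlAxisymmetric
open Summit.NavierStokesRegularity.NavierStokesRegularity.Theorems.PoloidalWindowDoorPoloidalWindowRigidityTimeShear
open Summit.NavierStokesRegularity.NavierStokesRegularity.Theorems.PoloidalWindowDoorPoloidalWindowRigidityFlat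

section Class

variable {C : ℝ} {v : ℝ → EuclideanSpace ℝ (Fin 3) → EuclideanSpace ℝ (Fin 3)}

/-- **A symmetry germ of a class profile forces `v ≡ 0`.**  For a profile of the route's Type-I class, poloidal along `e₃`:
if some slice `s < 0` carries on a nonempty open `U` a translation germ of the vorticity (`D(curl v(s))(y)[e] = 0`, `e ≠ 0`),
or a rotation germ about a vertical axis (`J curl v(s)(y) = D(curl v(s))(y)[J(y − c)]`), or agrees there with an entire
real-analytic field unbounded on `ℝ³`, then `v t x = 0` for all `t < 0`, `x`. -/
theorem eq_zero_of_germ (hrate : HasTypeITimeDecay C v)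
    (hcont : ContinuousOn (uncurry v) (Iio (0 : ℝ) ×ˢ univ))
    (hmild : ∀ s t : ℝ, s < t → t < 0 → ∀ x,
      v t x = UnboundedOperators.heatExtension (v s) (t - s) x - oseenDuhamel 1 s v v t x)
    (hdiv : ∀ t < 0, VectorCalculus.IsDivFree (v t))
    (hpol : ∀ s < 0, ∀ y, ⟪curl (v s) y, EuclideanSpace.single 2 1⟫_ℝ = 0)
    {s : ℝ} (hs : s < 0) {U : Set (EuclideanSpace ℝ (Fin 3))} (hU : IsOpen U) (hUne : U.Nonempty)
    (hgerm : (∃ e : EuclideanSpace ℝ (Fin 3), e ≠ 0 ∧ ∀ y ∈ U, fderiv ℝ (curl (v s)) y e = 0) ∨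
      (∃ c : EuclideanSpace ℝ (Fin 3), ∀ y ∈ U, rotGen (curl (v s) y) = fderiv ℝ (curl (v s)) y (rotGen (y - c))) ∨
      (∃ w : EuclideanSpace ℝ (Fin 3) → EuclideanSpace ℝ (Fin 3), AnalyticOnNhd ℝ w univ ∧
        ¬ BddAbove (Set.range fun y => ‖w y‖) ∧ ∀ y ∈ U, v s y = w y)) :
    ∀ t < 0, ∀ x, v t x = 0 := by
  rcases hgerm with ⟨e, he, htr⟩ | ⟨c, hrot⟩ | ⟨w, hw, hunb, heq⟩
  · exact eq_zero_of_curl_translate_eq_slice hrate hcont hmild hdiv hs he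
      (curl_translate_of_fderiv_eq_zero_on hrate hcont hmild hs hU hUne htr)
  · exact eq_zero_of_curl_rotDefect_eq_zero_on_open hrate hcont hmild hdiv hpol c hs hU hUne hrot
  · exact absurd heq (not_slice_eqOn_open_of_not_bddAbove hrate hcont hmild hs hw hunb hU hUne)

/-- **The germ trichotomy is contradictory on a profile with a vortical point.**  If in addition `curl v(s₀)(y₀) ≠ 0` at
some point of the slab, the germ hypothesis of `eq_zero_of_germ` is absurd. -/
theorem false_of_germ_of_nondegenerate (hrate : HasTypeITimeDecay C v)
    (hcont : ContinuousOn (uncurry v) (Iio (0 : ℝ) ×ˢ univ))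
    (hmild : ∀ s t : ℝ, s < t → t < 0 → ∀ x,
      v t x = UnboundedOperators.heatExtension (v s) (t - s) x - oseenDuhamel 1 s v v t x)
    (hdiv : ∀ t < 0, VectorCalculus.IsDivFree (v t))
    (hpol : ∀ s < 0, ∀ y, ⟪curl (v s) y, EuclideanSpace.single 2 1⟫_ℝ = 0)
    {s₀ : ℝ} (hs₀ : s₀ < 0) {y₀ : EuclideanSpace ℝ (Fin 3)} (hne : curl (v s₀) y₀ ≠ 0)
    {s : ℝ} (hs : s < 0) {U : Set (EuclideanSpace ℝ (Fin 3))} (hU : IsOpen U) (hUne : U.Nonempty)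
    (hgerm : (∃ e : EuclideanSpace ℝ (Fin 3), e ≠ 0 ∧ ∀ y ∈ U, fderiv ℝ (curl (v s)) y e = 0) ∨
      (∃ c : EuclideanSpace ℝ (Fin 3), ∀ y ∈ U, rotGen (curl (v s) y) = fderiv ℝ (curl (v s)) y (rotGen (y - c))) ∨
      (∃ w : EuclideanSpace ℝ (Fin 3) → EuclideanSpace ℝ (Fin 3), AnalyticOnNhd ℝ w univ ∧
        ¬ BddAbove (Set.range fun y => ‖w y‖) ∧ ∀ y ∈ U, v s y = w y)) : False := by
  have hzero := eq_zero_of_germ hrate hcont hmild hdiv hpol hs hU hUne hgerm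
  apply hne
  have hfun : v s₀ = fun _ => 0 := funext fun x => hzero s₀ hs₀ x
  rw [hfun]
  -- the curl of a constant field vanishes
  simp [curl]

end Class

/-! ### Transfer between the two registered (TH) stubs -/

/-- **This seat's 20428-stub `stub_timeHeightShearGerm` (germ currency) implies the K2 lead's v4 19708-stub
`stub_timeHeightShear` (`¬ IsBackwardSingularPoint` currency), VERBATIM** — one landing of the former closes both.  (The
germ it yields kills the profile by `eq_zero_of_germ`; `v ≡ 0` is not backward-singular.) -/
theorem timeHeightShear_of_germStub
    (h : ∀ (C : ℝ) (v : ℝ → EuclideanSpace ℝ (Fin 3) → EuclideanSpace ℝ (Fin 3)),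
      Literature.Analysis.FluidPDE.HasTypeITimeDecay C v →
      ContinuousOn (Function.uncurry v) (Set.Iio (0 : ℝ) ×ˢ Set.univ) →
      (∀ s t : ℝ, s < t → t < 0 → ∀ x, v t x =
        Literature.Analysis.UnboundedOperators.heatExtension (v s) (t - s) x -
          Literature.Analysis.FluidPDE.oseenDuhamel 1 s v v t x) →
      (∀ t < 0, Literature.Analysis.FluidPDE.VectorCalculus.IsDivFree (v t)) →
      (∀ s < 0, ∀ y, ⟪Literature.Analysis.FluidPDE.curl (v s) y, EuclideanSpace.single 2 1⟫_ℝ = 0) →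
      ∀ W : Set (ℝ × EuclideanSpace ℝ (Fin 3)), IsOpen W → W.Nonempty → W ⊆ Set.Iio (0 : ℝ) ×ˢ Set.univ →
        (∀ z ∈ W, Literature.Analysis.FluidPDE.curl (v z.1) z.2 ≠ 0 ∧
          (fderiv ℝ (v z.1) z.2 (EuclideanSpace.single 0 1) 2 ≠ 0 ∨ fderiv ℝ (v z.1) z.2 (EuclideanSpace.single 1 1) 2 ≠ 0) ∧
          (fderiv ℝ (v z.1) z.2 (EuclideanSpace.single 2 1) 0 ≠ 0 ∨ fderiv ℝ (v z.1) z.2 (EuclideanSpace.single 2 1) 1 ≠ 0)) →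
        (∀ m : ℝ → ℝ, ∀ W₁ : Set (ℝ × EuclideanSpace ℝ (Fin 3)), W₁ ⊆ W → IsOpen W₁ → W₁.Nonempty →
          ∃ z ∈ W₁, ∃ b : Fin 3, b ≠ 2 ∧
            fderiv ℝ (v z.1) z.2 (EuclideanSpace.single 2 1) b ≠
              m z.1 * fderiv ℝ (v z.1) z.2 (EuclideanSpace.single b 1) 2) →
        (∃ m : ℝ → ℝ → ℝ, ∀ z ∈ W, ∀ b : Fin 3, b ≠ 2 →
          fderiv ℝ (v z.1) z.2 (EuclideanSpace.single 2 1) b =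
            m z.1 (z.2 2) * fderiv ℝ (v z.1) z.2 (EuclideanSpace.single b 1) 2) →
        ∃ s : ℝ, s < 0 ∧ ∃ U : Set (EuclideanSpace ℝ (Fin 3)), IsOpen U ∧ U.Nonempty ∧
          ((∃ e : EuclideanSpace ℝ (Fin 3), e ≠ 0 ∧ ∀ y ∈ U, fderiv ℝ (Literature.Analysis.FluidPDE.curl (v s)) y e = 0) ∨
           (∃ c : EuclideanSpace ℝ (Fin 3), ∀ y ∈ U,
              Literature.Analysis.FluidPDE.rotGen (Literature.Analysis.FluidPDE.curl (v s) y) =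
                fderiv ℝ (Literature.Analysis.FluidPDE.curl (v s)) y (Literature.Analysis.FluidPDE.rotGen (y - c))) ∨
           (∃ w : EuclideanSpace ℝ (Fin 3) → EuclideanSpace ℝ (Fin 3), AnalyticOnNhd ℝ w Set.univ ∧
              ¬ BddAbove (Set.range fun y => ‖w y‖) ∧ ∀ y ∈ U, v s y = w y))) :
    ∀ (C : ℝ) (v : ℝ → EuclideanSpace ℝ (Fin 3) → EuclideanSpace ℝ (Fin 3)),
      Literature.Analysis.FluidPDE.HasTypeITimeDecay C v →
      ContinuousOn (Function.uncurry v) (Set.Iio (0 : ℝ) ×ˢ Set.univ) →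
      (∀ s t : ℝ, s < t → t < 0 → ∀ x, v t x =
        Literature.Analysis.UnboundedOperators.heatExtension (v s) (t - s) x -
          Literature.Analysis.FluidPDE.oseenDuhamel 1 s v v t x) →
      (∀ t < 0, Literature.Analysis.FluidPDE.VectorCalculus.IsDivFree (v t)) →
      (∀ s < 0, ∀ y, ⟪Literature.Analysis.FluidPDE.curl (v s) y, EuclideanSpace.single 2 1⟫_ℝ = 0) →
      ∀ W : Set (ℝ × EuclideanSpace ℝ (Fin 3)), IsOpen W → W.Nonempty → W ⊆ Set.Iio (0 : ℝ) ×ˢ Set.univ →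
        (∀ z ∈ W, Literature.Analysis.FluidPDE.curl (v z.1) z.2 ≠ 0 ∧
          (fderiv ℝ (v z.1) z.2 (EuclideanSpace.single 0 1) 2 ≠ 0 ∨ fderiv ℝ (v z.1) z.2 (EuclideanSpace.single 1 1) 2 ≠ 0) ∧
          (fderiv ℝ (v z.1) z.2 (EuclideanSpace.single 2 1) 0 ≠ 0 ∨ fderiv ℝ (v z.1) z.2 (EuclideanSpace.single 2 1) 1 ≠ 0)) →
        (∀ m : ℝ → ℝ, ∀ W₁ : Set (ℝ × EuclideanSpace ℝ (Fin 3)), W₁ ⊆ W → IsOpen W₁ → W₁.Nonempty →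
          ∃ z ∈ W₁, ∃ b : Fin 3, b ≠ 2 ∧
            fderiv ℝ (v z.1) z.2 (EuclideanSpace.single 2 1) b ≠
              m z.1 * fderiv ℝ (v z.1) z.2 (EuclideanSpace.single b 1) 2) →
        (∃ m : ℝ → ℝ → ℝ, ∀ z ∈ W, ∀ b : Fin 3, b ≠ 2 →
          fderiv ℝ (v z.1) z.2 (EuclideanSpace.single 2 1) b =
            m z.1 (z.2 2) * fderiv ℝ (v z.1) z.2 (EuclideanSpace.single b 1) 2) →
        ¬ Literature.Analysis.FluidPDE.IsBackwardSingularPoint v 0 := by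
  intro C v hrate hcont hmild hdiv hpol W hW hWne hWs hnd hpin hTH
  obtain ⟨s, hs, U, hU, hUne, hgerm⟩ := h C v hrate hcont hmild hdiv hpol W hW hWne hWs hnd hpin hTH
  exact not_backwardSingular_of_zero (eq_zero_of_germ hrate hcont hmild hdiv hpol hs hU hUne hgerm)

/-! ### What the item says inside the class -/

/-- **`LrcModEntire` ⟺ «time-only slope is open-dense in the non-degenerate region»**: the item holds iff for every
profile of the route's Type-I class, poloidal along `e₃`, and every nonempty open subset `W` of the slab on which the profile
is non-degenerate (`curl v ≠ 0`, `∇_h v₂ ≠ 0`, `∂₂v_h ≠ 0`), the shear slope is a function of time alone on SOME nonempty open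
`W₁ ⊆ W` (`∂₂v_b(z) = m(z.1) ∂_b v₂(z)` on `W₁`, `b = 0,1`). -/
theorem lrcModEntire_iff_timeOnly_dense :
    LrcModEntire ↔
      ∀ (C : ℝ) (v : ℝ → EuclideanSpace ℝ (Fin 3) → EuclideanSpace ℝ (Fin 3)),
        HasTypeITimeDecay C v →
        ContinuousOn (Function.uncurry v) (Set.Iio (0 : ℝ) ×ˢ Set.univ) →
        (∀ s t : ℝ, s < t → t < 0 → ∀ x, v t x =
          UnboundedOperators.heatExtension (v s) (t - s) x - oseenDuhamel 1 s v v t x) →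
        (∀ t < 0, VectorCalculus.IsDivFree (v t)) →
        (∀ s < 0, ∀ y, ⟪curl (v s) y, EuclideanSpace.single 2 1⟫_ℝ = 0) →
        ∀ W : Set (ℝ × EuclideanSpace ℝ (Fin 3)), IsOpen W → W.Nonempty → W ⊆ Set.Iio (0 : ℝ) ×ˢ Set.univ →
          (∀ z ∈ W, curl (v z.1) z.2 ≠ 0 ∧
            (fderiv ℝ (v z.1) z.2 (EuclideanSpace.single 0 1) 2 ≠ 0 ∨ fderiv ℝ (v z.1) z.2 (EuclideanSpace.single 1 1) 2 ≠ 0) ∧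
            (fderiv ℝ (v z.1) z.2 (EuclideanSpace.single 2 1) 0 ≠ 0 ∨ fderiv ℝ (v z.1) z.2 (EuclideanSpace.single 2 1) 1 ≠ 0)) →
          ∃ m : ℝ → ℝ, ∃ W₁ : Set (ℝ × EuclideanSpace ℝ (Fin 3)), W₁ ⊆ W ∧ IsOpen W₁ ∧ W₁.Nonempty ∧
            ∀ z ∈ W₁, ∀ b : Fin 3, b ≠ 2 →
              fderiv ℝ (v z.1) z.2 (EuclideanSpace.single 2 1) b = m z.1 * fderiv ℝ (v z.1) z.2 (EuclideanSpace.single b 1) 2 := by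
  constructor
  · intro hL C v hrate hcont hmild hdiv hpol W hW hWne hWs hnd
    by_contra hcon
    push Not at hcon
    have hpin : ∀ m : ℝ → ℝ, ∀ W₁ : Set (ℝ × EuclideanSpace ℝ (Fin 3)), W₁ ⊆ W → IsOpen W₁ → W₁.Nonempty →
        ∃ z ∈ W₁, ∃ b : Fin 3, b ≠ 2 ∧
          fderiv ℝ (v z.1) z.2 (EuclideanSpace.single 2 1) b ≠ m z.1 * fderiv ℝ (v z.1) z.2 (EuclideanSpace.single b 1) 2 := by
      intro m W₁ h1 h2 h3
      obtain ⟨z, hz, b, hb, hne⟩ := hcon m W₁ h1 h2 h3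
      exact ⟨z, hz, b, hb, hne⟩
    obtain ⟨s, hs, U, hU, hUne, hgerm⟩ := hL C v hrate hcont hmild hdiv hpol W hW hWne hWs hnd hpin
    obtain ⟨z₀, hz₀⟩ := hWne
    exact false_of_germ_of_nondegenerate hrate hcont hmild hdiv hpol (mem_prod.1 (hWs hz₀)).1 (hnd z₀ hz₀).1
      hs hU hUne hgerm
  · intro hR C v hrate hcont hmild hdiv hpol W hW hWne hWs hnd hpin
    obtain ⟨m, W₁, hW₁W, hW₁, hW₁ne, hid⟩ := hR C v hrate hcont hmild hdiv hpol W hW hWne hWs hnd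
    obtain ⟨z, hz, b, hb, hne⟩ := hpin m W₁ hW₁W hW₁ hW₁ne
    exact absurd (hid z hz b hb) hne

/-- **`LrcModEntire` ⟺ «every poloidal class profile with ONE vortical non-degenerate point of the slab is GLOBALLY (TV)»**:
the item holds iff for every profile of the route's Type-I class, poloidal along `e₃`, that is non-degenerate at some point
`(s₀, y₀)` of the slab (`curl v ≠ 0`, `∇_h v₂ ≠ 0`, `∂₂v_h ≠ 0` there), every slice `s < 0` is proportional-shear with one
NEGATIVE slope `μ(s)`: `∂₂v_b(s,y) = μ(s) ∂_b v₂(s,y)` for all `y`, `b = 0,1`.  (⇒: non-degeneracy is open, the previous form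
gives a time-only slope on an open set, and this base's `…TimeShear.timeShear_of_local` spreads it to all slices — the alternative
`v ≡ 0` contradicts the vortical point; ⇐: a global (TV) slope makes the item's «not time-only» hypothesis fail on every `W`.) -/
theorem lrcModEntire_iff_timeShear :
    LrcModEntire ↔
      ∀ (C : ℝ) (v : ℝ → EuclideanSpace ℝ (Fin 3) → EuclideanSpace ℝ (Fin 3)),
        HasTypeITimeDecay C v →
        ContinuousOn (Function.uncurry v) (Set.Iio (0 : ℝ) ×ˢ Set.univ) →
        (∀ s t : ℝ, s < t → t < 0 → ∀ x, v t x =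
          UnboundedOperators.heatExtension (v s) (t - s) x - oseenDuhamel 1 s v v t x) →
        (∀ t < 0, VectorCalculus.IsDivFree (v t)) →
        (∀ s < 0, ∀ y, ⟪curl (v s) y, EuclideanSpace.single 2 1⟫_ℝ = 0) →
        (∃ s₀ : ℝ, s₀ < 0 ∧ ∃ y₀ : EuclideanSpace ℝ (Fin 3), curl (v s₀) y₀ ≠ 0 ∧
          (fderiv ℝ (v s₀) y₀ (EuclideanSpace.single 0 1) 2 ≠ 0 ∨ fderiv ℝ (v s₀) y₀ (EuclideanSpace.single 1 1) 2 ≠ 0) ∧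
          (fderiv ℝ (v s₀) y₀ (EuclideanSpace.single 2 1) 0 ≠ 0 ∨ fderiv ℝ (v s₀) y₀ (EuclideanSpace.single 2 1) 1 ≠ 0)) →
        ∀ s < 0, ∃ μ : ℝ, μ < 0 ∧ ∀ y, ∀ b : Fin 3, b ≠ 2 →
          fderiv ℝ (v s) y (EuclideanSpace.single 2 1) b = μ * fderiv ℝ (v s) y (EuclideanSpace.single b 1) 2 := by
  rw [lrcModEntire_iff_timeOnly_dense]
  constructor
  · intro hD C v hrate hcont hmild hdiv hpol ⟨s₀, hs₀, y₀, hA, hB, hCc⟩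
    -- the non-degenerate part of the slab is a nonempty open set
    set O : Set (ℝ × EuclideanSpace ℝ (Fin 3)) := Iio (0 : ℝ) ×ˢ univ with hO
    have hOo : IsOpen O := isOpen_Iio.prod isOpen_univ
    have hanV := analyticOnNhd_uncurry hcont (bdd_of_hasTypeITimeDecay hrate) hmild
    have hcurlc : ContinuousOn (uncurry fun s y => curl (v s) y) O :=
      (analyticOnNhd_uncurry_curl hanV isOpen_Iio).continuousOn
    have hent : ∀ (j i : Fin 3), ContinuousOn
        (fun z : ℝ × EuclideanSpace ℝ (Fin 3) => fderiv ℝ (v z.1) z.2 (EuclideanSpace.single j 1) i) O :=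
      fun j i => Summit.NavierStokesRegularity.NavierStokesRegularity.Theorems.PoloidalWindowDoorPoloidalWindowRigidityK2OfLrcSlope.continuousOn_fderiv_entry hrate hcont hmild j i
    set z₀ : ℝ × EuclideanSpace ℝ (Fin 3) := (s₀, y₀) with hz₀
    have hz₀O : z₀ ∈ O := mk_mem_prod hs₀ (mem_univ _)
    have hOz : O ∈ 𝓝 z₀ := hOo.mem_nhds hz₀O
    have eA : ∀ᶠ w in 𝓝 z₀, curl (v w.1) w.2 ≠ 0 := ((hcurlc z₀ hz₀O).continuousAt hOz).eventually_ne hA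
    have eB : ∀ᶠ w in 𝓝 z₀, fderiv ℝ (v w.1) w.2 (EuclideanSpace.single 0 1) 2 ≠ 0 ∨
        fderiv ℝ (v w.1) w.2 (EuclideanSpace.single 1 1) 2 ≠ 0 := by
      rcases hB with hB | hB
      · exact (((hent 0 2) z₀ hz₀O).continuousAt hOz |>.eventually_ne hB).mono fun w hw => Or.inl hw
      · exact (((hent 1 2) z₀ hz₀O).continuousAt hOz |>.eventually_ne hB).mono fun w hw => Or.inr hw
    have eC : ∀ᶠ w in 𝓝 z₀, fderiv ℝ (v w.1) w.2 (EuclideanSpace.single 2 1) 0 ≠ 0 ∨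
        fderiv ℝ (v w.1) w.2 (EuclideanSpace.single 2 1) 1 ≠ 0 := by
      rcases hCc with hCc | hCc
      · exact (((hent 2 0) z₀ hz₀O).continuousAt hOz |>.eventually_ne hCc).mono fun w hw => Or.inl hw
      · exact (((hent 2 1) z₀ hz₀O).continuousAt hOz |>.eventually_ne hCc).mono fun w hw => Or.inr hw
    obtain ⟨W, hWsub, hWo, hz₀W⟩ := _root_.mem_nhds_iff.1 ((eA.and (eB.and eC)).and hOz)
    have hWne : W.Nonempty := ⟨z₀, hz₀W⟩
    have hWs : W ⊆ O := fun w hw => (hWsub hw).2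
    have hnd : ∀ z ∈ W, curl (v z.1) z.2 ≠ 0 ∧
        (fderiv ℝ (v z.1) z.2 (EuclideanSpace.single 0 1) 2 ≠ 0 ∨ fderiv ℝ (v z.1) z.2 (EuclideanSpace.single 1 1) 2 ≠ 0) ∧
        (fderiv ℝ (v z.1) z.2 (EuclideanSpace.single 2 1) 0 ≠ 0 ∨ fderiv ℝ (v z.1) z.2 (EuclideanSpace.single 2 1) 1 ≠ 0) :=
      fun z hz => (hWsub hz).1
    obtain ⟨m, W₁, hW₁W, hW₁, hW₁ne, hid⟩ := hD C v hrate hcont hmild hdiv hpol W hWo hWne hWs hnd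
    rcases timeShear_of_local hrate hcont hmild hdiv hpol hW₁ hW₁ne (hW₁W.trans hWs) hid with hzero | hall
    · exfalso
      apply hA
      have hfun : v s₀ = fun _ => 0 := funext fun x => hzero s₀ hs₀ x
      rw [hfun]
      simp [curl]
    · exact hall
  · intro hT C v hrate hcont hmild hdiv hpol W hW hWne hWs hnd
    obtain ⟨z₀, hz₀⟩ := hWne
    have hs₀ : z₀.1 < 0 := (mem_prod.1 (hWs hz₀)).1
    have hall := hT C v hrate hcont hmild hdiv hpol ⟨z₀.1, hs₀, z₀.2, hnd z₀ hz₀⟩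
    choose μ hμneg hμ using hall
    refine ⟨fun t => if ht : t < 0 then μ t ht else 0, W, Subset.rfl, hW, ⟨z₀, hz₀⟩, fun z hz b hb => ?_⟩
    have hz1 : z.1 < 0 := (mem_prod.1 (hWs hz)).1
    simp only [dif_pos hz1]
    exact hμ z.1 hz1 z.2 b hb

end Summit.NavierStokesRegularity.NavierStokesRegularity.Theorems.PoloidalWindowDoorLrcModEntireIff

end
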